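import Summits.QuantumFields.BalabanUV.T4Continuum.Spine.NE1p.DressedTowerWitnessEnd
import Summits.QuantumFields.BalabanUV.T4Continuum.Spine.NE1p.DressedStabilityOfWinSchedules

/-!
# T⁴ programme, spine estimate NE1′ (node O3b/H2) — NON-VACUITY OF THE ALL-CUTOFF WINDOW FACE: leaf-03-g2's W5 toy tower fed to
# the END-ALL-win THEOREM ITSELF (swarm item W5c of `t4/formal/NE1p/LEAVES.md` v2.4; INTENT CLAIMS.log l.10279)

Cell `pub-balaban`, sub-cell `t4`, BINDER-OWNERS row NE1′, formalisation crew `b2b-balaban-t4-ne1p-formalise-*`, seat `…-leaf-09`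
(gen 2).  ADDITIVE — imports leaf-03-g2's `Spine/NE1p/DressedTowerWitnessEnd` (row W5 part 2, p214143: the decided toy tower `towerW`
with ONE cutoff-free schedule `Wg = WindowScheduleWin.geometric 1 1 (LW²)⁻¹ ¼ 1 0` and ONE K-free `UW`, its per-cutoff binder lemmas
`hslW`, `FnW_succ`, `realBaseAt_W`, `exponentSliceAt_W`, `pertSlice_W`, `hDμW`, `hratioW`, `hdefwkW`, `hrateW`, `hlinW`, `hregW`,
`hcountW`, `hbirthW`) and this seat's `Spine/NE1p/DressedStabilityOfWinSchedules` (row S3g part 2, p213964: the all-cutoff window face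
`dressedStability_win_of_schedules`) ONLY; modifies nothing.  THE DATUM IS LEAF-03-g2's; this file only re-routes it.

WHAT.  W5 reaches the root `DressedStability towerW` twice — through END-B `dressedStability_of_cell` (`dressedStability_towerW`) and
through S3g part 1's bundle (`dressedStability_towerW'`).  Here the SAME datum is fed to the all-cutoff theorem
`dressedStability_win_of_schedules` with EVERY hypothesis a `(p, K)`-FAMILY `fun _ K => …W K…`, ONE schedule `fun _ _ => Wg` and the
scalars of `UW` bound once.  So the ≈ 40 indexed hypothesis families of the END-ALL-win
face are JOINTLY INHABITED (at every cutoff, by one cutoff-free schedule and one K-free scalar set) and the theorem's conclusion is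
reached from them — non-vacuity of the BINDER SHAPES of S3g-2, in kernel — in the DISPLAYED-CONSTANTS form
`DressedStabilityWith towerW 1 (rhoOne LW⁻² 2 0 ½) LW⁻³` (W5's own theorems state the existential root; the gate's dedup rule makes
the same proposition un-restatable, and the With-form is the informative one anyway): **`dressedStabilityWith_towerW_allCutoffs`**,
`rhoOne_towerW_lt_one` (the toy's family factor `ρ₁ ≤ ¼ < 1`), `sizeBound_towerW_allCutoffs` (the consumer face at every cutoff).

HONEST FRAMING.  A decided toy ([folklore]; 0 sorry; 0 citations; no `def`): two-point fluctuation laws, affine carried functions,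
trivial weights — NOTHING of Bałaban's densities, windows or D-terms; the walls (w1)∕(w2-act)∕(I4′)∕(w5) are inhabited here by TOY
data only.  Headline (c4): «the all-cutoff window face's binder families are jointly inhabitable; NE1′ ⇐ the named binders, NOT
proved»; spine PROVED 0∕9.  Rung (B)+1 on ONE finite four-torus — NOT infinite volume, NOT a mass gap, NOT OS on ℝ⁴, NOT Clay.
HONEST DEPENDENCY: continuum YM on T⁴ ⇐ BetaPertH ∧ nine spine estimates (0/9 proved); BetaPertH ⇐ (D1) ∧ (D4) ∧ CAP+tail; G-an2-4
gates asym, D1 and NE2/3/4.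
-/

noncomputable section

namespace Summit.QuantumFields.BalabanUV.T4Continuum.NE1p.DressedTowerWitnessAllCutoffs

open Literature.MathematicalPhysics.QuantumFieldTheory.Balaban1983to89
open Summit.QuantumFields.BalabanUV.T4Continuum.T4TrajectoryDensityDressed
open Summit.QuantumFields.BalabanUV.T4Continuum.T4TrajectoryDensityWitness
open Summit.QuantumFields.BalabanUV.T4Continuum.NE1p.DressedRoot
open Summit.QuantumFields.BalabanUV.T4Continuum.NE1p.DressedUniformConstants
open Summit.QuantumFields.BalabanUV.T4Continuum.NE1p.DressedTowerWitness
open Summit.QuantumFields.BalabanUV.T4Continuum.NE1p.DressedStabilityOfWinSchedules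

/-- **W5's TOWER THROUGH THE END-ALL-win THEOREM, CONSTANTS DISPLAYED** [decided toy]: `DressedStabilityWith towerW 1
(rhoOne LW⁻² 2 0 ½) LW⁻³` — the row root WITH the cell's constants `(A₀, ρ₁, τ) = (1, LW⁻²·alphaCell ½ + 2·0, LW⁻³)` — by
`DressedStabilityOfWinSchedules.dressedStabilityWith_win_of_schedules` with the single cutoff-free schedule `fun _ _ => Wg`, the
scalars of `UW` (`κ = ½`, `L = LW`, `c̄ = 0`, `N₀ = A₀ = 1`, `s̄⁰ = ρ′ = ½`, `r = 1`, `c_δ = ½`, `m = ¼`) bound ONCE, and every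
estimate ∕ dictionary ∕ booking-level binder the toy's per-cutoff lemma as a `(p, K)`-family.  (W5's own `dressedStability_towerW`
is the existential root through END-B directly; this is the displayed-constants class through the all-cutoff theorem — a different
statement, the same toy.)  Non-vacuity of the binder shapes of the all-cutoff window face; nothing of Bałaban's densities. [folklore] -/
theorem dressedStabilityWith_towerW_allCutoffs :
    DressedStabilityWith towerW 1 (rhoOne (LW ^ 2)⁻¹ (4 * (1 / 2) / 1) 0 (1 / 2)) (LW⁻¹ ^ 3) :=
  dressedStabilityWith_win_of_schedules towerW (κ := 1 / 2) (L := LW) (cbar := 0) (N₀ := 1) (A₀ := 1) (sbar := 1 / 2)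
    (ρ' := 1 / 2) (r := 1) (cδ := 1 / 2) (m := 1 / 4) (w := fun _ _ => 1) (fun _ _ => Wg)
    (Fn := fun _ K _ k' k => FnW K k' k) (rel := fun _ _ _ _ _ U U' => U = U')
    (ref := fun _ _ _ _ U => U) (base := fun _ _ _ _ => base₁) (𝒜 := fun _ _ _ _ => zeroExp) (𝒬 := fun _ _ _ _ => zeroExp)
    (q := fun _ _ _ _ _ => 0) (μ := fun _ _ _ k => flAt (atomW k)) (z₀ := fun _ _ _ _ => 0)
    (defect := fun _ _ _ _ k => defW k) (s := fun _ _ _ _ => 0) (S := fun _ _ _ b => {b}) (creg := fun _ _ _ => 0)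
    (fun _ _ => hratioW) one_le_LW le_rfl (by norm_num) zero_le_one zero_le_one (by norm_num) (locCell_LW _).le (by norm_num)
    (by norm_num) one_pos (by norm_num)
    (fun _ K b k' _ _ _ => hslW K b k') (fun _ K _ k' k _ _ _ _ U => FnW_succ K k' k U)
    (fun _ _ _ _ k _ _ _ _ _ => mem_bddClass_flAt _ _) (fun _ _ _ _ k _ _ _ _ => realBaseAt_W _ _)
    (fun _ _ _ _ k _ _ _ _ => exponentSliceAt_W _ _ _)
    (fun _ K b _ k _ _ _ _ => pertSlice_W _ _ _ (budgetShare_nonneg K b k))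
    (fun _ _ _ k => hDμW k) (fun _ _ _ _ _ _ _ h => h ▸ rfl) (fun _ _ _ _ k => hdefwkW k)
    (fun _ _ _ k' k _ _ _ => hrateW k' k) (fun _ K b k' k _ _ _ _ ε hε => hlinW K b k' k ε hε)
    (fun _ _ _ => le_rfl) (fun _ _ _ _ => le_rfl) (fun _ K => hregW K) (fun _ _ _ _ => by norm_num)
    (fun _ _ k _ _ _ => Nat.zero_le k) (fun _ K => hcountW K) (fun _ K => hbirthW K)

/-- [decided toy] The toy's family factor through the all-cutoff face is STRICTLY below one: `ρ₁ = LW⁻²·alphaCell ½ < 1` — the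
class decays along each family (`LW = 2·alphaCell ½`, so `ρ₁ = 1∕(4·alphaCell ½) ≤ 1∕4`). [folklore] -/
theorem rhoOne_towerW_lt_one : rhoOne (LW ^ 2)⁻¹ (4 * (1 / 2) / 1) 0 (1 / 2) < 1 := by
  have hα : 0 < alphaCell (1 / 2) := alphaCell_pos (by norm_num)
  have h1 : 1 < alphaCell (1 / 2) :=
    lt_of_lt_of_le (Real.one_lt_exp_iff.mpr (by norm_num)) (exp_three_le_alphaCell (by norm_num))
  have hL : LW = 2 * alphaCell (1 / 2) := rfl
  unfold rhoOne
  rw [hL]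
  have h4 : 0 < (2 * alphaCell (1 / 2)) ^ 2 := by positivity
  rw [mul_zero, add_zero, inv_mul_eq_div, div_lt_one h4]
  nlinarith

/-- [decided toy] Hence, from the displayed-constants class, every booked size of the toy is below `A₀ = 1` times the decaying
two-rate profile at EVERY cutoff (END's consumer face `sizeBound_of_dressedStabilityWith` BY NAME). [folklore] -/
theorem sizeBound_towerW_allCutoffs (p : Unit) (K : ℕ) :
    (towerW.B p K).SizeBound
      (twoRate 1 (rhoOne (LW ^ 2)⁻¹ (4 * (1 / 2) / 1) 0 (1 / 2)) (LW⁻¹ ^ 3) (towerW.B p K).K) :=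
  sizeBound_of_dressedStabilityWith dressedStabilityWith_towerW_allCutoffs p K

end Summit.QuantumFields.BalabanUV.T4Continuum.NE1p.DressedTowerWitnessAllCutoffs

end
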